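/-
Origin: expansion seat `planner-pub-hodgecm-pv03-0`, handover 2026-08-18T03:28:28Z (`HOME/pub-hodgecm-pv03/lean/Pv03/PerL34/DenseEquivariance.lean`, md5 0e4d95fc, 53 lines);
landed by the gen-5 packager in gate run 18 as `HodgeCM/PerL34/DenseEquivariance.lean` (verbatim).
-/
/-
pub-hodgecm — DAG-node prover pv03 (session planner-pub-hodgecm-pv03-0).  Warm-up leaf for PerL v5 Prop 4.3
(`prop:S12`), the density step of the line-field argument, tex ll. 670–677: a line field equivariant under the
dense subgroup `G_U(L₀) ⊂ U(2,1)` (real approximation: Sansuc Cor. 3.5(iii), Platonov–Rapinchuk Thm 7.7) and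
continuous at `x₀` is invariant under the full stabiliser `K_{x₀}`.  Pure Mathlib; no HodgeCM import.
-/
import Mathlib.Topology.Algebra.MulAction
import Mathlib.Algebra.Group.Subgroup.Defs

set_option autoImplicit false

/-!
# Equivariance under a dense subgroup + continuity at a point ⇒ invariance under the stabiliser

`HodgeCM.PerL34.DenseEquivariance.smul_apply_eq_of_dense`: `G` a topological group acting continuously on
`X` and on a Hausdorff space `Y`, `D ⊆ G` dense, `f : X → Y` continuous AT `x₀` with `f (d • x₀) = d • f x₀`
for all `d ∈ D`; then every `k ∈ G` fixing `x₀` fixes `f x₀`.  (PerL v5 Prop 4.3, tex ll. 670–680, with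
`X = 𝔹²` (the value of `f` off the open set `Ω ∋ x₀` where the line field lives is irrelevant: only continuity
at `x₀` and equivariance along the `D`-orbit of `x₀` are used), `Y` = lines in `T^*𝔹²`, `D = G_U(L₀)`,
`G = U(2,1)(ℝ)`, `k ∈ K_{x₀} ≅ U(2) × U(1)`.)
-/

namespace HodgeCM.PerL34.DenseEquivariance

open Filter Topology

variable {G X Y : Type*} [TopologicalSpace G] [Monoid G] [TopologicalSpace X] [TopologicalSpace Y]
  [MulAction G X] [MulAction G Y] [ContinuousSMul G X] [ContinuousSMul G Y] [T2Space Y]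

/-- **Dense equivariance ⇒ stabiliser invariance.**  If `f (d • x₀) = d • f x₀` for all `d` in a dense subset
`D` of `G`, `f` is continuous at `x₀`, and `k • x₀ = x₀`, then `k • f x₀ = f x₀`. -/
theorem smul_apply_eq_of_dense (D : Set G) (hD : Dense D) (f : X → Y) (x₀ : X) (hf : ContinuousAt f x₀)
    (heq : ∀ d ∈ D, f (d • x₀) = d • f x₀) (k : G) (hk : k • x₀ = x₀) : k • f x₀ = f x₀ := by
  haveI : (𝓝[D] k).NeBot := mem_closure_iff_nhdsWithin_neBot.mp (hD k)
  have hc : Continuous (fun g : G => g • x₀) := continuous_id.smul continuous_const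
  have h1 : Tendsto (fun g : G => f (g • x₀)) (𝓝[D] k) (𝓝 (f (k • x₀))) := by
    exact (hf.comp_of_eq hc.continuousAt hk).tendsto.mono_left nhdsWithin_le_nhds
  have h2 : Tendsto (fun g : G => g • f x₀) (𝓝[D] k) (𝓝 (k • f x₀)) :=
    ((continuous_id.smul continuous_const).tendsto k).mono_left nhdsWithin_le_nhds
  have heq' : (fun g : G => f (g • x₀)) =ᶠ[𝓝[D] k] (fun g => g • f x₀) :=
    eventually_nhdsWithin_of_forall (fun g hg => heq g hg)
  have h := tendsto_nhds_unique_of_eventuallyEq h1 h2 heq'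
  rw [hk] at h
  exact h.symm

/-- Subgroup form (PerL: `D = G_U(L₀)`, dense in `G = G_U(L₀ ⊗ ℝ) ≅ U(2,1)` by real approximation). -/
theorem smul_apply_eq_of_dense_subgroup {G : Type*} [TopologicalSpace G] [Group G] [MulAction G X]
    [MulAction G Y] [ContinuousSMul G X] [ContinuousSMul G Y] (D : Subgroup G) (hD : Dense (D : Set G))
    (f : X → Y) (x₀ : X) (hf : ContinuousAt f x₀) (heq : ∀ d ∈ D, f (d • x₀) = d • f x₀) (k : G)
    (hk : k • x₀ = x₀) : k • f x₀ = f x₀ :=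
  smul_apply_eq_of_dense (D : Set G) hD f x₀ hf (fun d hd => heq d hd) k hk

end HodgeCM.PerL34.DenseEquivariance
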